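import Literature.NumberTheory.GaloisRepresentations.NeukirchBaseChangeRat
import Literature.NumberTheory.GaloisRepresentations.NeukirchFiniteSupportNF
import Literature.NumberTheory.GaloisRepresentations.NeukirchHasseNF
import Literature.NumberTheory.GaloisRepresentations.NeukirchTwoPlaceNF
import HarnessLib

/-!
# The global hypotheses of Neukirch's lemma at an open subgroup of `Gal(\bar ℚ/ℚ)`

Topic `NumberTheory/GaloisRepresentations`; namespace
`Literature.NumberTheory.GaloisRepresentations.ExplicitMuCocycles`.  Proof file: theorems only (no
definition, no instance, no named fact).

SETTING ([NeukirchSchmidtWingberg2008] XII §1, proof of (12.1.9); [Neukirch1969] §2).  `Γ = Gal(Ω/ℚ)`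
(`absoluteGaloisGroup ℚ`, `Ω = AlgebraicClosure ℚ`) acts on the nonarchimedean primes of `Ω`
(valuation subrings `A ≠ ⊤`, stabiliser `D_A = MulAction.stabilizer Γ A`).  Cochains are explicit:
`f : Γ → Γ → ℤ/ℓ` read on a subgroup `S`, as in `NeukirchAbstractUniqueness.lean`.  For an OPEN
subgroup `V ≤ Γ` the abstract containment lemma (`NeukirchAbstract.exists_prime_smul_eq_of_localType`)
needs three global inputs about cocycles on `V` and the groups `D_A ∩ V`; here they are, first at
`V = Γ_K` for a number field `K ⊆ Ω`, then for any open `V` via `K = K_V = Ω^V` (`ΓK_KV`):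

* **(AxH) Hasse injectivity** `coboundaryOn_of_forall_coboundaryOn_stabilizer_inf`: a cocycle on `V`
  which cobounds on every `D_A ∩ V` cobounds on `V` (for `V` fixing a primitive `ℓ`-th root of unity,
  `ℓ` odd);
* **(AxF) finite support** `finite_setOf_exists_not_coboundaryOn_stabilizer_inf`: a cocycle on `V`
  cobounds on `D_A ∩ V` for all `A` outside finitely many rational places;
* **(AxG) two-place separation** `exists_cocycleOn_not_coboundaryOn_and_coboundaryOn_stabilizer_inf`:
  for `A₁, A₂` not `V`-conjugate there is a cocycle on `V` non-cobounding on `D_{A₁} ∩ V` and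
  cobounding on `D_{A₂} ∩ V` (for `V` fixing a primitive `ℓ`-th root of unity).

METHOD: base change (`NeukirchBaseChangeRat.lean`) to the tree's full-group theorems
`coboundary_of_forall_coboundaryOn_decompositionSubgroup` (NeukirchHasseNF),
`finite_setOf_not_coboundaryOn_decompositionSubgroup` (NeukirchFiniteSupportNF) and
`exists_cocycle_not_coboundaryOn_and_coboundaryOn` (NeukirchTwoPlaceNF).

## References

* J. Neukirch, A. Schmidt, K. Wingberg, *Cohomology of Number Fields* (2nd ed. 2008), XII §1,
  (12.1.9)–(12.1.10). [NeukirchSchmidtWingberg2008]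
* J. Neukirch, *Kennzeichnung der p-adischen und der endlichen algebraischen Zahlkörper*,
  Invent. Math. 6 (1969) 296–314, §2. [Neukirch1969]
* J. Neukirch, *Algebraic Number Theory* (1999), Ch. I §3 (places of `ℚ`). [NeukirchANT1999]
* J.-P. Serre, *Galois Cohomology* (1997), I §2.2 (explicit cochains). [SerreGaloisCohomology1997]
-/

noncomputable section

open Function Field IsDedekindDomain NumberField IntermediateField
open scoped Pointwise

namespace Literature.NumberTheory.GaloisRepresentations.ExplicitMuCocycles

open Literature.NumberTheory.GaloisRepresentations Literature.AnabelianGeometry.AbsoluteAnabelian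
open Literature.AnabelianGeometry.AbsoluteAnabelian.NeukirchUchidaProof
open Literature.GroupTheory.LocallyConstantCocycles

/-! ### The three global hypotheses at `Γ_K`, `K ⊆ Ω` a number field -/

section Level

variable (K : IntermediateField ℚ (AlgebraicClosure ℚ)) [NumberField K]

/-- From `T.map galTransport = D.subgroupOf Γ_K`: `galTransport x ∈ D ∩ Γ_K ↔ x ∈ T`.
[cite: NeukirchSchmidtWingberg2008, Thm (12.2.1)] -/
private theorem galTransport_mem_inf_iff {T : Subgroup (absoluteGaloisGroup K)}
    {D : Subgroup (absoluteGaloisGroup ℚ)}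
    (h : T.map (galTransport K).toMonoidHom = D.subgroupOf (ΓK K)) (x : absoluteGaloisGroup K) :
    ((galTransport K x : ΓK K) : absoluteGaloisGroup ℚ) ∈ D ⊓ ΓK K ↔ x ∈ T := by
  rw [Subgroup.mem_inf, and_iff_left (galTransport K x).2, ← Subgroup.mem_subgroupOf, ← h,
    ← Subgroup.mem_map_iff_mem (f := (galTransport K).toMonoidHom) (galTransport K).injective]
  rfl

/-- Pull-back of a cochain on `Γ_K ≤ Γ` to the abstract group `Gal(\bar K/K)` along `galTransport`:
locally constant and a cocycle on the whole group. [cite: SerreGaloisCohomology1997, I §2.2] -/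
private theorem exists_pullback_galTransport {R : Type*} [AddCommGroup R]
    (f : absoluteGaloisGroup ℚ → absoluteGaloisGroup ℚ → R)
    (hlc : IsLocallyConstant (fun q : ΓK K × ΓK K => f q.1 q.2))
    (hcoc : ∀ a ∈ ΓK K, ∀ b ∈ ΓK K, ∀ c ∈ ΓK K, f a b + f (a * b) c = f b c + f a (b * c)) :
    ∃ d : absoluteGaloisGroup K → absoluteGaloisGroup K → R, IsLocallyConstant (uncurry d) ∧
      (∀ a b c, d a b + d (a * b) c = d b c + d a (b * c)) ∧
      ∀ a b, f (galTransport K a) (galTransport K b) = d a b := by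
  refine ⟨fun a b => f (galTransport K a) (galTransport K b), ?_, ?_, fun _ _ => rfl⟩
  · have heq : (uncurry fun a b => f (galTransport K a) (galTransport K b)) =
        (fun q : ΓK K × ΓK K => f q.1 q.2) ∘
          fun x : absoluteGaloisGroup K × absoluteGaloisGroup K =>
            (galTransport K x.1, galTransport K x.2) := by
      funext x; rfl
    rw [heq]
    exact hlc.comp_continuous (((galTransport K).continuous.comp continuous_fst).prodMk
      ((galTransport K).continuous.comp continuous_snd))
  · intro a b c
    have hab : ((galTransport K a : ΓK K) : absoluteGaloisGroup ℚ) * (galTransport K b : ΓK K) =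
        (galTransport K (a * b) : ΓK K) := by rw [map_mul, Subgroup.coe_mul]
    have hbc : ((galTransport K b : ΓK K) : absoluteGaloisGroup ℚ) * (galTransport K c : ΓK K) =
        (galTransport K (b * c) : ΓK K) := by rw [map_mul, Subgroup.coe_mul]
    have := hcoc _ (galTransport K a).2 _ (galTransport K b).2 _ (galTransport K c).2
    rw [hab, hbc] at this
    exact this

/-- **(AxH) at `Γ_K`.**  Let `ℓ` be an odd prime and `ζ ∈ K` a primitive `ℓ`-th root of unity.  A
cochain `f` on `Γ = Gal(Ω/ℚ)`, locally constant and a `2`-cocycle on `Γ_K`, which is a coboundary (of a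
cochain locally constant there) on `D_A ∩ Γ_K` for every nonarchimedean prime `A` of `Ω`, is a coboundary
on `Γ_K` of a cochain locally constant on `Γ_K` — Hasse injectivity
`H²(K, ℤ/ℓ) ↪ ⊕_w H²(K_w, ℤ/ℓ)` ([NSW] (9.1.10)/(8.1.16) with `μ_ℓ ⊂ K`), via
`coboundary_of_forall_coboundaryOn_decompositionSubgroup` and base change.
[cite: NeukirchSchmidtWingberg2008, XII §1 (12.1.9)] -/
theorem coboundaryOn_ΓK_of_forall_stabilizer {ℓ : ℕ} (hℓ : ℓ.Prime) (hℓ2 : ℓ ≠ 2)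
    {ζ : AlgebraicClosure ℚ} (hζ : IsPrimitiveRoot ζ ℓ) (hζK : ζ ∈ K)
    {V : Subgroup (absoluteGaloisGroup ℚ)} (hKV : ΓK K = V)
    (f : absoluteGaloisGroup ℚ → absoluteGaloisGroup ℚ → ZMod ℓ)
    (hlc : IsLocallyConstant (fun q : V × V => f q.1 q.2))
    (hcoc : ∀ a ∈ V, ∀ b ∈ V, ∀ c ∈ V, f a b + f (a * b) c = f b c + f a (b * c))
    (hloc : ∀ A : ValuationSubring (AlgebraicClosure ℚ), A ≠ ⊤ →
      ∃ γ : absoluteGaloisGroup ℚ → ZMod ℓ,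
        IsLocallyConstant (fun s : ↥(MulAction.stabilizer (absoluteGaloisGroup ℚ) A ⊓ V) => γ s) ∧
        ∀ a ∈ MulAction.stabilizer (absoluteGaloisGroup ℚ) A ⊓ V,
          ∀ b ∈ MulAction.stabilizer (absoluteGaloisGroup ℚ) A ⊓ V, f a b = γ a + γ b - γ (a * b)) :
    ∃ β : absoluteGaloisGroup ℚ → ZMod ℓ, IsLocallyConstant (fun s : V => β s) ∧
      ∀ a ∈ V, ∀ b ∈ V, f a b = β a + β b - β (a * b) := by
  subst hKV
  set ζK : K := ⟨ζ, hζK⟩ with hζKdef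
  have hζK' : IsPrimitiveRoot ζK ℓ := IsPrimitiveRoot.coe_submonoidClass_iff.mp (by exact hζ)
  obtain ⟨d, hdlc, hdcoc, hde⟩ := exists_pullback_galTransport K f hlc hcoc
  have hdloc : ∀ w : HeightOneSpectrum (𝓞 K), ∃ γ : absoluteGaloisGroup K → ZMod ℓ,
      IsLocallyConstant
        (fun s : ↥((adicCompletionPrime K w).decompositionSubgroup (absoluteGaloisGroup K)) => γ s) ∧
      ∀ a ∈ (adicCompletionPrime K w).decompositionSubgroup (absoluteGaloisGroup K),
        ∀ b ∈ (adicCompletionPrime K w).decompositionSubgroup (absoluteGaloisGroup K),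
          d a b = γ a + γ b - γ (a * b) := by
    intro w
    obtain ⟨A, hA, hmap⟩ := exists_ne_top_map_galTransport_eq K w
    exact coboundaryOn_of_coboundaryOn_corresponding (ΓK K) (galTransport K) hde
      (galTransport_mem_inf_iff K hmap) (hloc A hA)
  obtain ⟨β', hβ', hd⟩ :=
    coboundary_of_forall_coboundaryOn_decompositionSubgroup K hℓ hℓ2 hζK' d hdlc hdcoc hdloc
  exact coboundaryOn_of_coboundary (ΓK K) (galTransport K) hde hβ' hd

/-- Places of `ℚ` are determined by the integers they contain: the set of places `v` with prescribed
`{n ∈ ℤ | n ∈ 𝔭_v}` has at most one element. [cite: NeukirchANT1999, Ch. I §3] -/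
private theorem subsingleton_setOf_forall_intCast_mem_iff (P : ℤ → Prop) :
    {v : HeightOneSpectrum (𝓞 ℚ) | ∀ n : ℤ, (n : 𝓞 ℚ) ∈ v.asIdeal ↔ P n}.Subsingleton := by
  intro v hv v' hv'
  ext r
  have hr : ((Rat.ringOfIntegersEquiv r : ℤ) : 𝓞 ℚ) = r := by
    rw [← map_intCast Rat.ringOfIntegersEquiv.symm (Rat.ringOfIntegersEquiv r)]
    exact Rat.ringOfIntegersEquiv.symm_apply_apply r
  rw [← hr, hv, hv']

/-- **(AxF) at `Γ_K`.**  A cochain `f` on `Γ`, locally constant and a `2`-cocycle on `Γ_K`, is a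
coboundary on `D_A ∩ Γ_K` (of a cochain locally constant there) for every nonarchimedean prime `A` of
`Ω` outside a finite set of rational places (finite support of `H²(K, ℤ/ℓ) → ⊕_w H²(K_w, ℤ/ℓ)`,
`finite_setOf_not_coboundaryOn_decompositionSubgroup`, and base change; the places of `ℚ` below the
finitely many bad places of `K`). [cite: NeukirchSchmidtWingberg2008, XII §1 (12.1.9)] -/
theorem finite_setOf_exists_not_coboundaryOn_stabilizer_inf_ΓK {ℓ : ℕ} (hℓ : ℓ.Prime)
    {V : Subgroup (absoluteGaloisGroup ℚ)} (hKV : ΓK K = V)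
    (f : absoluteGaloisGroup ℚ → absoluteGaloisGroup ℚ → ZMod ℓ)
    (hlc : IsLocallyConstant (fun q : V × V => f q.1 q.2))
    (hcoc : ∀ a ∈ V, ∀ b ∈ V, ∀ c ∈ V, f a b + f (a * b) c = f b c + f a (b * c)) :
    Set.Finite {v : HeightOneSpectrum (𝓞 ℚ) | ∃ A : ValuationSubring (AlgebraicClosure ℚ), A ≠ ⊤ ∧
      (∃ 𝔓 ∈ v.primesAbove, ∀ s : absIntegers (𝓞 ℚ) ℚ, s ∈ 𝔓 ↔ (s : AlgebraicClosure ℚ) ∈ A.nonunits) ∧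
      ¬ ∃ γ : absoluteGaloisGroup ℚ → ZMod ℓ,
        IsLocallyConstant (fun s : ↥(MulAction.stabilizer (absoluteGaloisGroup ℚ) A ⊓ V) => γ s) ∧
        ∀ a ∈ MulAction.stabilizer (absoluteGaloisGroup ℚ) A ⊓ V,
          ∀ b ∈ MulAction.stabilizer (absoluteGaloisGroup ℚ) A ⊓ V, f a b = γ a + γ b - γ (a * b)} := by
  subst hKV
  haveI : Fact ℓ.Prime := ⟨hℓ⟩
  obtain ⟨d, hdlc, hdcoc, hde⟩ := exists_pullback_galTransport K f hlc hcoc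
  have hfin := finite_setOf_not_coboundaryOn_decompositionSubgroup K d hdlc hdcoc
  refine ((hfin.biUnion (t := fun w => {v : HeightOneSpectrum (𝓞 ℚ) |
      ∀ n : ℤ, (n : 𝓞 ℚ) ∈ v.asIdeal ↔ (n : 𝓞 K) ∈ w.asIdeal})
    fun w _ => (subsingleton_setOf_forall_intCast_mem_iff _).finite).subset ?_)
  rintro v ⟨A, hA, ⟨𝔓, h𝔓v, hdicA⟩, hbad⟩
  obtain ⟨w, 𝔔, h𝔔w, hmap, hmatch⟩ := exists_primesAbove_map_galTransport_eq K A hA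
  rw [Set.mem_iUnion₂]
  refine ⟨w, ?_, fun n => ?_⟩
  · intro hcobw
    apply hbad
    have hcob𝔔 := (coboundaryOn_decompositionSubgroup_iff_of_mem_primesAbove K hℓ
      (adicCompletionPrime_mem_primesAbove K w) h𝔔w d hdlc hdcoc).mp hcobw
    exact coboundaryOn_corresponding_of_coboundaryOn (ΓK K) (galTransport K) hde inf_le_right
      (galTransport_mem_inf_iff K hmap) hcob𝔔
  · haveI := h𝔓v.2
    rw [← hmatch n, Ideal.LiesOver.over (P := 𝔓) (p := v.asIdeal), Ideal.under_def, Ideal.mem_comap,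
      map_intCast, hdicA]
    simp

/-- **(AxG) at `Γ_K`.**  Let `ζ ∈ K` be a primitive `ℓ`-th root of unity.  For nonarchimedean primes
`A₁, A₂` of `Ω` which are not conjugate under `Γ_K` there is a cochain `z` on `Γ`, locally constant and a
`2`-cocycle on `Γ_K`, which is NOT a coboundary on `D_{A₁} ∩ Γ_K` but IS a coboundary on `D_{A₂} ∩ Γ_K`
(a global class with prescribed local components at the two distinct places of `K` below `A₁, A₂`:
`exists_cocycle_not_coboundaryOn_and_coboundaryOn`, and base change).
[cite: NeukirchSchmidtWingberg2008, XII §1 (12.1.9)] -/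
theorem exists_cocycleOn_ΓK_not_coboundaryOn_and_coboundaryOn {ℓ : ℕ} (hℓ : ℓ.Prime)
    {ζ : AlgebraicClosure ℚ} (hζ : IsPrimitiveRoot ζ ℓ) (hζK : ζ ∈ K)
    {V : Subgroup (absoluteGaloisGroup ℚ)} (hKV : ΓK K = V)
    {A₁ A₂ : ValuationSubring (AlgebraicClosure ℚ)} (hA₁ : A₁ ≠ ⊤) (hA₂ : A₂ ≠ ⊤)
    (h : ∀ g ∈ V, g • A₁ ≠ A₂) :
    ∃ z : absoluteGaloisGroup ℚ → absoluteGaloisGroup ℚ → ZMod ℓ,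
      IsLocallyConstant (fun q : V × V => z q.1 q.2) ∧
      (∀ a ∈ V, ∀ b ∈ V, ∀ c ∈ V, z a b + z (a * b) c = z b c + z a (b * c)) ∧
      (¬ ∃ β : absoluteGaloisGroup ℚ → ZMod ℓ,
        IsLocallyConstant (fun s : ↥(MulAction.stabilizer (absoluteGaloisGroup ℚ) A₁ ⊓ V) => β s) ∧
        ∀ a ∈ MulAction.stabilizer (absoluteGaloisGroup ℚ) A₁ ⊓ V,
          ∀ b ∈ MulAction.stabilizer (absoluteGaloisGroup ℚ) A₁ ⊓ V, z a b = β a + β b - β (a * b)) ∧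
      ∃ β : absoluteGaloisGroup ℚ → ZMod ℓ,
        IsLocallyConstant (fun s : ↥(MulAction.stabilizer (absoluteGaloisGroup ℚ) A₂ ⊓ V) => β s) ∧
        ∀ a ∈ MulAction.stabilizer (absoluteGaloisGroup ℚ) A₂ ⊓ V,
          ∀ b ∈ MulAction.stabilizer (absoluteGaloisGroup ℚ) A₂ ⊓ V, z a b = β a + β b - β (a * b) := by
  subst hKV
  set ζK : K := ⟨ζ, hζK⟩ with hζKdef
  have hζK' : IsPrimitiveRoot ζK ℓ := IsPrimitiveRoot.coe_submonoidClass_iff.mp (by exact hζ)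
  obtain ⟨w₁, 𝔔₁, h𝔔₁, hmap₁, -⟩ := exists_primesAbove_map_galTransport_eq K A₁ hA₁
  obtain ⟨w₂, 𝔔₂, h𝔔₂, hmap₂, -⟩ := exists_primesAbove_map_galTransport_eq K A₂ hA₂
  have hw : w₁ ≠ w₂ := by
    rintro rfl
    obtain ⟨g, hg, hgA⟩ := exists_mem_ΓK_smul_eq_of_primesAbove K hA₁ hA₂ h𝔔₁ h𝔔₂ hmap₁ hmap₂
    exact h g hg hgA
  obtain ⟨z', hz'lc, hz'coc, hn₁, hc₂⟩ :=
    exists_cocycle_not_coboundaryOn_and_coboundaryOn K hℓ hζK' hw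
  obtain ⟨z, hzlc, hzcoc, hze⟩ := exists_cochainOn_of_cochain (ΓK K) (galTransport K) z' hz'lc hz'coc
  refine ⟨z, hzlc, hzcoc, fun hcob => hn₁ ?_, ?_⟩
  · have h𝔔 := coboundaryOn_of_coboundaryOn_corresponding (ΓK K) (galTransport K) hze
      (galTransport_mem_inf_iff K hmap₁) hcob
    exact (coboundaryOn_decompositionSubgroup_iff_of_mem_primesAbove K hℓ h𝔔₁
      (adicCompletionPrime_mem_primesAbove K w₁) z' hz'lc hz'coc).mp h𝔔
  · have h𝔔 := (coboundaryOn_decompositionSubgroup_iff_of_mem_primesAbove K hℓ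
      (adicCompletionPrime_mem_primesAbove K w₂) h𝔔₂ z' hz'lc hz'coc).mp hc₂
    exact coboundaryOn_corresponding_of_coboundaryOn (ΓK K) (galTransport K) hze inf_le_right
      (galTransport_mem_inf_iff K hmap₂) h𝔔

end Level

/-! ### The three hypotheses at an arbitrary open subgroup `V ≤ Γ` -/

section Open

variable {ℓ : ℕ} (V : Subgroup (absoluteGaloisGroup ℚ)) (hV : IsOpen (V : Set (absoluteGaloisGroup ℚ)))

/-- An element of `Ω` fixed by `V` lies in the fixed field `K_V`. [cite: NeukirchANT1999, Ch. IV §1] -/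
private theorem mem_KV_of_forall_smul_eq {x : AlgebraicClosure ℚ} (hx : ∀ g ∈ V, g • x = x) :
    x ∈ KV V :=
  (IntermediateField.mem_fixedField_iff _ x).mpr (by rintro _ ⟨g, hg, rfl⟩; exact hx g hg)

include hV in
/-- **(AxH) at an open `V ≤ Γ` fixing `ζ_ℓ`** (`ℓ` an odd prime): a cochain on `Γ`, locally constant and
a `2`-cocycle on `V`, which cobounds on every `D_A ∩ V`, cobounds on `V`.
[cite: NeukirchSchmidtWingberg2008, XII §1 (12.1.9)] -/
theorem coboundaryOn_of_forall_coboundaryOn_stabilizer_inf (hℓ : ℓ.Prime) (hℓ2 : ℓ ≠ 2)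
    {ζ : AlgebraicClosure ℚ} (hζ : IsPrimitiveRoot ζ ℓ) (hVζ : ∀ g ∈ V, g • ζ = ζ)
    (f : absoluteGaloisGroup ℚ → absoluteGaloisGroup ℚ → ZMod ℓ)
    (hlc : IsLocallyConstant (fun q : V × V => f q.1 q.2))
    (hcoc : ∀ a ∈ V, ∀ b ∈ V, ∀ c ∈ V, f a b + f (a * b) c = f b c + f a (b * c))
    (hloc : ∀ A : ValuationSubring (AlgebraicClosure ℚ), A ≠ ⊤ →
      ∃ γ : absoluteGaloisGroup ℚ → ZMod ℓ,
        IsLocallyConstant (fun s : ↥(MulAction.stabilizer (absoluteGaloisGroup ℚ) A ⊓ V) => γ s) ∧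
        ∀ a ∈ MulAction.stabilizer (absoluteGaloisGroup ℚ) A ⊓ V,
          ∀ b ∈ MulAction.stabilizer (absoluteGaloisGroup ℚ) A ⊓ V, f a b = γ a + γ b - γ (a * b)) :
    ∃ β : absoluteGaloisGroup ℚ → ZMod ℓ, IsLocallyConstant (fun s : V => β s) ∧
      ∀ a ∈ V, ∀ b ∈ V, f a b = β a + β b - β (a * b) := by
  haveI := finiteDimensional_KV V hV
  haveI : NumberField (KV V) := numberField_intermediateField (KV V)
  exact coboundaryOn_ΓK_of_forall_stabilizer (KV V) hℓ hℓ2 hζ (mem_KV_of_forall_smul_eq V hVζ)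
    (ΓK_KV V hV) f hlc hcoc hloc

include hV in
/-- **(AxF) at an open `V ≤ Γ`**: a cochain on `Γ`, locally constant and a `2`-cocycle on `V`, cobounds
on `D_A ∩ V` for all nonarchimedean primes `A` of `Ω` outside finitely many rational places.
[cite: NeukirchSchmidtWingberg2008, XII §1 (12.1.9)] -/
theorem finite_setOf_exists_not_coboundaryOn_stabilizer_inf (hℓ : ℓ.Prime)
    (f : absoluteGaloisGroup ℚ → absoluteGaloisGroup ℚ → ZMod ℓ)
    (hlc : IsLocallyConstant (fun q : V × V => f q.1 q.2))
    (hcoc : ∀ a ∈ V, ∀ b ∈ V, ∀ c ∈ V, f a b + f (a * b) c = f b c + f a (b * c)) :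
    Set.Finite {v : HeightOneSpectrum (𝓞 ℚ) | ∃ A : ValuationSubring (AlgebraicClosure ℚ), A ≠ ⊤ ∧
      (∃ 𝔓 ∈ v.primesAbove, ∀ s : absIntegers (𝓞 ℚ) ℚ, s ∈ 𝔓 ↔ (s : AlgebraicClosure ℚ) ∈ A.nonunits) ∧
      ¬ ∃ γ : absoluteGaloisGroup ℚ → ZMod ℓ,
        IsLocallyConstant (fun s : ↥(MulAction.stabilizer (absoluteGaloisGroup ℚ) A ⊓ V) => γ s) ∧
        ∀ a ∈ MulAction.stabilizer (absoluteGaloisGroup ℚ) A ⊓ V,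
          ∀ b ∈ MulAction.stabilizer (absoluteGaloisGroup ℚ) A ⊓ V, f a b = γ a + γ b - γ (a * b)} := by
  haveI := finiteDimensional_KV V hV
  haveI : NumberField (KV V) := numberField_intermediateField (KV V)
  exact finite_setOf_exists_not_coboundaryOn_stabilizer_inf_ΓK (KV V) hℓ (ΓK_KV V hV) f hlc hcoc

include hV in
/-- **(AxG) at an open `V ≤ Γ` fixing `ζ_ℓ`**: nonarchimedean primes `A₁, A₂` of `Ω` that are not
`V`-conjugate are separated by a cochain on `Γ`, locally constant and a `2`-cocycle on `V`, which is not a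
coboundary on `D_{A₁} ∩ V` but is one on `D_{A₂} ∩ V`. [cite: NeukirchSchmidtWingberg2008, XII §1 (12.1.9)] -/
theorem exists_cocycleOn_not_coboundaryOn_and_coboundaryOn_stabilizer_inf (hℓ : ℓ.Prime)
    {ζ : AlgebraicClosure ℚ} (hζ : IsPrimitiveRoot ζ ℓ) (hVζ : ∀ g ∈ V, g • ζ = ζ)
    {A₁ A₂ : ValuationSubring (AlgebraicClosure ℚ)} (hA₁ : A₁ ≠ ⊤) (hA₂ : A₂ ≠ ⊤)
    (h : ∀ g ∈ V, g • A₁ ≠ A₂) :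
    ∃ z : absoluteGaloisGroup ℚ → absoluteGaloisGroup ℚ → ZMod ℓ,
      IsLocallyConstant (fun q : V × V => z q.1 q.2) ∧
      (∀ a ∈ V, ∀ b ∈ V, ∀ c ∈ V, z a b + z (a * b) c = z b c + z a (b * c)) ∧
      (¬ ∃ β : absoluteGaloisGroup ℚ → ZMod ℓ,
        IsLocallyConstant (fun s : ↥(MulAction.stabilizer (absoluteGaloisGroup ℚ) A₁ ⊓ V) => β s) ∧
        ∀ a ∈ MulAction.stabilizer (absoluteGaloisGroup ℚ) A₁ ⊓ V,
          ∀ b ∈ MulAction.stabilizer (absoluteGaloisGroup ℚ) A₁ ⊓ V, z a b = β a + β b - β (a * b)) ∧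
      ∃ β : absoluteGaloisGroup ℚ → ZMod ℓ,
        IsLocallyConstant (fun s : ↥(MulAction.stabilizer (absoluteGaloisGroup ℚ) A₂ ⊓ V) => β s) ∧
        ∀ a ∈ MulAction.stabilizer (absoluteGaloisGroup ℚ) A₂ ⊓ V,
          ∀ b ∈ MulAction.stabilizer (absoluteGaloisGroup ℚ) A₂ ⊓ V, z a b = β a + β b - β (a * b) := by
  haveI := finiteDimensional_KV V hV
  haveI : NumberField (KV V) := numberField_intermediateField (KV V)
  exact exists_cocycleOn_ΓK_not_coboundaryOn_and_coboundaryOn (KV V) hℓ hζ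
    (mem_KV_of_forall_smul_eq V hVζ) (ΓK_KV V hV) hA₁ hA₂ h

end Open

end Literature.NumberTheory.GaloisRepresentations.ExplicitMuCocycles

end
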